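import Summits.ResolutionOfSingularities.ResolutionOfSingularities.Theorems.FrobeniusClosingPatchingRelPerfectConeTiltCharts
import HarnessLib

/-!
# Crux `PatchingRelPerfect` (stmt-ResolutionOfSingularities-16161), chain w52 — the PERMISSIBLE
# TILT FAMILY of the cone at depth two, `(x₀x₁ + x₂² + x₃μ) + 𝔪⁴`, `μ ∈ (x₀, x₁, x₂)·𝔪` — charts

[OURS · L1 W5.2 · rung] Kernel sentence (iii) at the quadric cone, the TAME half as one family:
for `S` regular local with regular system of parameters `x₀, …, x₃`, `q = x₀x₁ + x₂²`,
`P = (x₀, x₁, x₂)` and ANY `μ ∈ P·𝔪`, the depth-two member `I = (q + x₃μ) + 𝔪⁴` — generically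
NOT `u`-graded — keeps the vertex `z₀` weight-two-permissible, and the r2c/r2c♯ tower (this seat:
`…ConeDepthTwo*.lean`, `…ConeTilt*.lean`) runs uniformly: on the Rees chart `B_i` of `Bl_𝔪`,
`φ(x₃μ) = u³ m` with `m ∈ (e₀, e₁, e₂)` (`exists_tilt`), the residual is `(F + u m, u²)`; on the
charts of `Bl_{z₀}` the strict transform of `f` is the tilted conic `G + u'm'`, `ψ(m) = w m'`.
`μ = 0` is r2c, `μ = x₂x₃` is r2c♯.  Identities half, any ring (`m`, `m'` abstract):

* level one: `exists_tilt`, `chartBase_q_add_mul`, `map_chartBase_I2m`, `map_chartBase_L'm`,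
  `map_chartBase_I2Qm`, `map_chartBase_I2Qm_of_ne_three`, `span_u_F_add_mul`;
* level two: `exists_tilt_two`, `chartBase_F_add_mul_two`, `map_chartBase_LLm`, `map_chartBase_KKm`,
  `map_chartBase_LKm`, `map_chartBase_LKm_zero`, `map_chartBase_LKm_succ`, `span_pair_tilt'`.

FORMAT evidence for the core only; nothing here is a statement of the manuscript under review.

## References

* The Stacks Project, Tags 080A, 0804. [StacksProject]
* Q. Liu, *Algebraic Geometry and Arithmetic Curves*, OUP 2002, Thm. 8.1.19 (a). [Liu2002]
-/

-- `Summit.<Summit>.<Sub>.Theorems` with `Sub = Summit` (single-conjunct summit, D-0017)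
set_option linter.dupNamespace false

noncomputable section

open CategoryTheory CategoryTheory.Limits AlgebraicGeometry Literature.AlgebraicGeometry.Resolution
open IsLocalRing

namespace Summit.ResolutionOfSingularities.ResolutionOfSingularities.Theorems

namespace ConeRung

universe u

/-! ## Level one: `I = (q + x₃μ) + 𝔪⁴` on the Rees charts of `Bl_𝔪` -/

section LevelOne

variable {S : Type u} [CommRing S] (x : Fin 4 → S) (μ : S) (i : Fin 4) (m : chartRing x i)

local notation3 "M" => Ideal.span (Set.range x)
local notation3 "I2m" => Ideal.span {x 0 * x 1 + x 2 ^ 2 + x 3 * μ} ⊔ Ideal.span (Set.range x) ^ 4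
local notation3 "PP" => Ideal.span {x 0, x 1, x 2}
local notation3 "φ" => chartBase x i
local notation3 "u" => chartBase x i (x i)
local notation3 "e[" j "]" => chartGen x i j
local notation3 "F" => chartGen x i 0 * chartGen x i 1 + chartGen x i 2 ^ 2

/-- **The tilt on a chart**: for `μ ∈ P·𝔪`, `φ(x₃μ) = u³ m` with `m ∈ (e₀, e₁, e₂)`.
[cite: StacksProject, Tag 0804] -/
theorem exists_tilt (hμ : μ ∈ PP * M) :
    ∃ m : chartRing x i, m ∈ Ideal.span {e[0], e[1], e[2]} ∧ φ (x 3 * μ) = u ^ 3 * m := by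
  have h1 : φ μ ∈ (PP * M).map φ := Ideal.mem_map_of_mem _ hμ
  rw [Ideal.map_mul, map_chartBase_P, map_chartBase_M, mul_assoc, mul_comm (Ideal.span {e[0], e[1], e[2]}),
    ← mul_assoc, Ideal.span_singleton_mul_span_singleton, Ideal.mem_span_singleton_mul] at h1
  obtain ⟨m₀, hm₀, hm₀'⟩ := h1
  refine ⟨e[3] * m₀, Ideal.mul_mem_left _ _ hm₀, ?_⟩
  rw [map_mul, reesChartBase_apply_eq_mul_chartGen x i 3, ← hm₀']
  ring

/-- `φ(q + x₃μ) = u² (F + u m)` when `φ(x₃μ) = u³ m`. [folklore] -/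
theorem chartBase_q_add_mul (hm : φ (x 3 * μ) = u ^ 3 * m) :
    φ (x 0 * x 1 + x 2 ^ 2 + x 3 * μ) = u ^ 2 * (F + u * m) := by
  rw [map_add, chartBase_q, hm]
  ring

/-- `(u, F + u m) = (u, F)`. [folklore] -/
theorem span_u_F_add_mul : Ideal.span {u, F + u * m} = Ideal.span {u, F} :=
  span_pair_add_mul _ _ _

/-- **`I B_i = u² · ((F + u m) + (u²))`**. [folklore] -/
theorem map_chartBase_I2m (hm : φ (x 3 * μ) = u ^ 3 * m) :
    (I2m).map φ = Ideal.span {u} ^ 2 * (Ideal.span {F + u * m} ⊔ Ideal.span {u} ^ 2) := by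
  rw [Ideal.map_sup, Ideal.map_pow, map_chartBase_M, Ideal.map_span, Set.image_singleton,
    chartBase_q_add_mul x μ i m hm, span_pow_mul, Ideal.mul_sup, ← pow_add]

/-- **`(I + 𝔪² (P + 𝔪²)) B_i = u² · ((F + u m) + u · (u, e₀, e₁, e₂))`**. [folklore] -/
theorem map_chartBase_L'm (hm : φ (x 3 * μ) = u ^ 3 * m) :
    (I2m ⊔ M ^ 2 * (PP ⊔ M ^ 2)).map φ =
      Ideal.span {u} ^ 2 *
        (Ideal.span {F + u * m} ⊔ Ideal.span {u} * Ideal.span {u, e[0], e[1], e[2]}) := by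
  rw [Ideal.map_sup, map_chartBase_I2m x μ i m hm, Ideal.map_mul, Ideal.map_pow, map_chartBase_M,
    map_chartBase_PM, ← Ideal.mul_sup, sup_assoc]
  have hle : Ideal.span {u} ^ 2 ≤ Ideal.span {u} * Ideal.span {u, e[0], e[1], e[2]} := by
    rw [sq]
    exact Ideal.mul_mono_right (Ideal.span_mono (Set.singleton_subset_iff.mpr (Set.mem_insert _ _)))
  rw [sup_eq_right.mpr hle]

/-- **The total transform of `I · Q`** on every chart. [folklore] -/
theorem map_chartBase_I2Qm (hm : φ (x 3 * μ) = u ^ 3 * m) :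
    (I2m * ((PP ⊔ M ^ 2) * (I2m ⊔ M ^ 2 * (PP ⊔ M ^ 2)))).map φ =
      Ideal.span {u ^ 5} *
        (((Ideal.span {F + u * m} ⊔ Ideal.span {u} * Ideal.span {u, e[0], e[1], e[2]}) *
            (Ideal.span {F + u * m} ⊔ Ideal.span {u} ^ 2)) *
          Ideal.span {u, e[0], e[1], e[2]}) := by
  rw [Ideal.map_mul, Ideal.map_mul, map_chartBase_I2m x μ i m hm, map_chartBase_PM,
    map_chartBase_L'm x μ i m hm, ← Ideal.span_singleton_pow]
  ring

/-- **On the charts `i = 0, 1, 2`: `(I Q) B_i = u⁵ · (u, F + u m) · ((F + u m) + (u²))`**.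
[folklore] -/
theorem map_chartBase_I2Qm_of_ne_three (hi : i ≠ 3) (hm : φ (x 3 * μ) = u ^ 3 * m) :
    (I2m * ((PP ⊔ M ^ 2) * (I2m ⊔ M ^ 2 * (PP ⊔ M ^ 2)))).map φ =
      Ideal.span {u ^ 5} *
        (Ideal.span {u, F + u * m} * (Ideal.span {F + u * m} ⊔ Ideal.span {u ^ 2})) := by
  rw [map_chartBase_I2Qm x μ i m hm, span_u_e_eq_top_of_ne_three x i hi, Ideal.mul_top,
    Ideal.mul_top, Ideal.span_insert u {F + u * m}, sup_comm (Ideal.span {u}) _,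
    Ideal.span_singleton_pow]

end LevelOne

/-! ## Level two: `L = (F + t m) + t (t, v)`, `K = (F + t m) + (t²)`, `m ∈ (v₀, v₁, v₂)` -/

section LevelTwo

variable {A : Type u} [CommRing A] (t : A) (v : Fin 3 → A) (m : A) (j : Fin 4)
  (m' : chartRing (Fin.cons t v : Fin 4 → A) j)

local notation3 "cc" => (Fin.cons t v : Fin 4 → A)
local notation3 "F" => v 0 * v 1 + v 2 ^ 2
local notation3 "LLm" => Ideal.span {v 0 * v 1 + v 2 ^ 2 + t * m} ⊔
  Ideal.span {t} * Ideal.span {t, v 0, v 1, v 2}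
local notation3 "KKm" => Ideal.span {v 0 * v 1 + v 2 ^ 2 + t * m} ⊔ Ideal.span {t} ^ 2
local notation3 "ψ" => chartBase cc j
local notation3 "w" => chartBase cc j (cc j)
local notation3 "e'[" l "]" => chartGen cc j l
local notation3 "G" => chartGen cc j 1 * chartGen cc j 2 + chartGen cc j 3 ^ 2

/-- **The tilt on a chart of `Bl_{(c)}`**: for `m ∈ (v₀, v₁, v₂)`, `ψ(m) = w m'` for some `m'`.
[cite: StacksProject, Tag 0804] -/
theorem exists_tilt_two (hm : m ∈ Ideal.span {v 0, v 1, v 2}) :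
    ∃ m' : chartRing cc j, ψ m = w * m' := by
  have h1 : ψ m ∈ (Ideal.span {v 0, v 1, v 2}).map ψ := Ideal.mem_map_of_mem _ hm
  rw [map_chartBase_span_v] at h1
  obtain ⟨m', -, hm'⟩ := Ideal.mem_span_singleton_mul.mp h1
  exact ⟨m', hm'.symm⟩

/-- `F + t m - F ∈ (t)`. [folklore] -/
theorem F_add_mul_sub_mem : F + t * m - F ∈ Ideal.span {t} := by
  rw [show F + t * m - F = t * m by ring]
  exact Ideal.mul_mem_right _ _ (Ideal.subset_span rfl)

/-- **`ψ(F + t m) = w² (G + u' m')`** when `ψ(m) = w m'`. [folklore] -/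
theorem chartBase_F_add_mul_two (hm' : ψ m = w * m') : ψ (F + t * m) = w ^ 2 * (G + e'[0] * m') := by
  rw [map_add, chartBase_F_two, map_mul, chartBase_t_two, hm']
  ring

/-- `(u', G + u' m') = (u', G)`. [folklore] -/
theorem span_pair_tilt' : Ideal.span {e'[0], G + e'[0] * m'} = Ideal.span {e'[0], G} :=
  span_pair_add_mul _ _ _

/-- **`L C_j = w² · ((G + u'm') + (u'))`**. [folklore] -/
theorem map_chartBase_LLm (hm' : ψ m = w * m') :
    (LLm).map ψ = Ideal.span {w} ^ 2 * (Ideal.span {G + e'[0] * m'} ⊔ Ideal.span {e'[0]}) := by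
  rw [Ideal.map_sup, Ideal.map_mul, Ideal.map_span, Set.image_singleton,
    chartBase_F_add_mul_two t v m j m' hm', Ideal.map_span, Set.image_singleton, chartBase_t_two,
    map_chartBase_span_t_v, span_pow_mul, ← Ideal.span_singleton_mul_span_singleton, mul_assoc,
    mul_comm (Ideal.span {e'[0]}), ← mul_assoc, ← sq, ← Ideal.mul_sup]

/-- **`K C_j = w² · ((G + u'm') + (u'²))`**. [folklore] -/
theorem map_chartBase_KKm (hm' : ψ m = w * m') :
    (KKm).map ψ = Ideal.span {w} ^ 2 * (Ideal.span {G + e'[0] * m'} ⊔ Ideal.span {e'[0] ^ 2}) := by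
  rw [Ideal.map_sup, Ideal.map_pow, Ideal.map_span, Set.image_singleton,
    chartBase_F_add_mul_two t v m j m' hm', Ideal.map_span, Set.image_singleton, chartBase_t_two,
    span_pow_mul, ← Ideal.span_singleton_mul_span_singleton, mul_pow, ← Ideal.mul_sup,
    Ideal.span_singleton_pow (chartGen cc j 0) 2]

/-- **The total transform of `L · K`**: `(L K) C_j = w⁴ · ((u', G + u'm') · ((G + u'm') + (u'²)))`.
[folklore] -/
theorem map_chartBase_LKm (hm' : ψ m = w * m') :
    (LLm * KKm).map ψ =
      Ideal.span {w ^ 4} *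
        (Ideal.span {e'[0], G + e'[0] * m'} * (Ideal.span {G + e'[0] * m'} ⊔ Ideal.span {e'[0] ^ 2})) := by
  rw [Ideal.map_mul, map_chartBase_LLm t v m j m' hm', map_chartBase_KKm t v m j m' hm',
    mul_mul_mul_comm, span_sq_mul_span_sq, Ideal.span_insert (chartGen cc j 0),
    sup_comm (Ideal.span {e'[0]})]

end LevelTwo

section LevelTwoCharts

variable {A : Type u} [CommRing A] (t : A) (v : Fin 3 → A) (m : A)

local notation3 "cc" => (Fin.cons t v : Fin 4 → A)
local notation3 "LLm" => Ideal.span {v 0 * v 1 + v 2 ^ 2 + t * m} ⊔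
  Ideal.span {t} * Ideal.span {t, v 0, v 1, v 2}
local notation3 "KKm" => Ideal.span {v 0 * v 1 + v 2 ^ 2 + t * m} ⊔ Ideal.span {t} ^ 2

/-- **On the `t`-chart everything is Cartier**: `(L K) C₀ = (w⁴)`. [folklore] -/
theorem map_chartBase_LKm_zero (m' : chartRing cc 0) (hm' : chartBase cc 0 m = chartBase cc 0 (cc 0) * m') :
    (LLm * KKm).map (chartBase cc 0) = Ideal.span {chartBase cc 0 (cc 0) ^ 4} := by
  rw [map_chartBase_LKm t v m 0 m' hm']
  have h1 : chartGen cc 0 0 = 1 := chartGen_self cc 0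
  have hu : IsUnit (chartGen cc 0 0) := by rw [h1]; exact isUnit_one
  have htop : Ideal.span {chartGen cc 0 0,
      chartGen cc 0 1 * chartGen cc 0 2 + chartGen cc 0 3 ^ 2 + chartGen cc 0 0 * m'} = ⊤ :=
    Ideal.eq_top_of_isUnit_mem _ (Ideal.subset_span (Or.inl rfl)) hu
  have htop' : Ideal.span {chartGen cc 0 0 ^ 2} = ⊤ :=
    Ideal.eq_top_of_isUnit_mem _ (Ideal.subset_span rfl) (hu.pow 2)
  rw [htop, htop', sup_top_eq, Ideal.top_mul, Ideal.mul_top]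

/-- **On the `v_k`-chart**: `(L K) C_j = w⁴ · ∏_{k<2} ((G♯) + (u', G♯)ᵏ⁺¹)`, `G♯ = G + u'm'` — the
two-step tower for the pair `(u', G♯)`. [folklore] -/
theorem map_chartBase_LKm_succ (k : Fin 3) (m' : chartRing cc (Fin.succ k))
    (hm' : chartBase cc (Fin.succ k) m = chartBase cc (Fin.succ k) (cc (Fin.succ k)) * m') :
    (LLm * KKm).map (chartBase cc (Fin.succ k)) =
      Ideal.span {chartBase cc (Fin.succ k) (cc (Fin.succ k)) ^ 4} *
        ∏ l ∈ Finset.range 2,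
          (Ideal.span (Set.range ((Fin.cons (chartGen cc (Fin.succ k) 0)
              (fun _ : Fin 1 => chartGen cc (Fin.succ k) 1 * chartGen cc (Fin.succ k) 2 +
                chartGen cc (Fin.succ k) 3 ^ 2 + chartGen cc (Fin.succ k) 0 * m') :
                  Fin 2 → chartRing cc (Fin.succ k)) ∘
              (fun _ : Fin 1 => (1 : Fin 2)))) ⊔
            Ideal.span (Set.range (Fin.cons (chartGen cc (Fin.succ k) 0)
              (fun _ : Fin 1 => chartGen cc (Fin.succ k) 1 * chartGen cc (Fin.succ k) 2 +
                chartGen cc (Fin.succ k) 3 ^ 2 + chartGen cc (Fin.succ k) 0 * m') :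
                  Fin 2 → chartRing cc (Fin.succ k))) ^ (l + 1)) := by
  rw [CoreRungTower.towerTwo_eq, map_chartBase_LKm t v m (Fin.succ k) m' hm']

end LevelTwoCharts

end ConeRung

end Summit.ResolutionOfSingularities.ResolutionOfSingularities.Theorems

end
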